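import Literature.AlgebraicGeometry.Motives.AbelianVarietyDegreeGrowth
import Literature.AlgebraicGeometry.Motives.FiniteFlatSandwich
import HarnessLib

/-!
# `deg(f^*D) = deg(f) · deg(D)` for `h⁰`-asymptotic degrees (Görtz–Wedhorn II, Prop. 23.84)
# from asymptotic Riemann–Roch (Prop. 23.83) and the `h⁰`-sandwich

The named fact `CartierDivisor.asympDegree_pullback_eq` (`Motives/AbelianVarietyDegree`) records
Görtz–Wedhorn II, Prop. 23.84 — `deg(f^*𝓛) = deg(f) deg(𝓛)` for `f : X → Y` finite (flat,
surjective, of constant rank `r`) between integral proper `K`-schemes — with both degrees read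
through Prop. 23.83 as the leading coefficients `asympDegree` of `n ↦ h⁰(n D)` resp.
`n ↦ h⁰(n f^*D)` (`D` ample). The printed proof (via Prop. 23.77) uses intersection numbers, the
projection formula and `Rf_*`, none of which Mathlib has. This file proves the fact **from
Prop. 23.83 alone** (`CartierDivisor.asymptoticRiemannRoch_of_isAmple`, which stays a named fact):

* `CartierDivisor.asympDegree_pullback_eq_of_asymptoticRiemannRoch :
    asymptoticRiemannRoch_of_isAmple → asympDegree_pullback_eq`.

Proof: by Prop. 23.83, `h⁰(nD) = δ nᵉ/e! + O(nᵉ⁻¹)` and `h⁰(n f^*D) = δ' nᵉ/e! + O(nᵉ⁻¹)` with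
`δ, δ' > 0`, `e = dim Y = dim X` (`schemeDim_eq_of_isFinite_of_surjective`); in particular both
spaces of sections are finite-dimensional for `n ≫ 0`. The cohomology-free sandwich
`r h⁰(mD) ≤ h⁰((m+a) f^*D)`, `h⁰(m f^*D) ≤ r h⁰((m+a) D)` (`CartierDivisor.exists_sandwich_h0`,
`Motives/FiniteFlatSandwich`, with `r = [K(X) : K(Y)] = rank f`,
`FunctionFieldOver.finrank_eq_finrank_of_forall_eq`) then gives, after dividing by `mᵉ` and
letting `m → ∞`, `r δ ≤ δ'` and `δ' ≤ r δ`, i.e. `δ' = r δ`.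

So the degree formula enters the proof of `deg [n]_A = n^{2g}` (Görtz–Wedhorn II, Prop. 27.186;
`AbelianVariety.kerRank_zsmul_id_of_facts`) only through Prop. 23.83:
`AbelianVariety.kerRank_zsmul_id_of_asymptoticRiemannRoch` and
`AbelianVariety.natCard_torsionPoints_of_isAlgClosed_of_asymptoticRiemannRoch` restate those
assemblies with the hypothesis `asympDegree_pullback_eq` discharged.

## The sandwich hypothesis (S) of `Motives/AbelianVarietyDegreeGrowth` from crude growth (G)

`Motives/AbelianVarietyDegreeGrowth` proves `deg [n]_A = n^{2g}` and `#A[n](L) = n^{2g}` from two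
hypotheses on sections of ample divisors over `K`, entering as section variables: **(G)** crude
growth `c mᵍ ≤ h⁰(mD) ≤ C mᵍ` (`m ≫ 0`, `c > 0`) for `D` ample on an integral proper `K`-scheme of
dimension `g`, and **(S)** the sandwich `r h⁰(mD) ≤ h⁰((m+a) f^*D)`, `h⁰(m f^*D) ≤ r h⁰((m+a) D)`
(`m ≫ 0`) for `f` finite flat surjective of constant rank `r` between integral proper `K`-schemes,
`D` ample. `Motives/FiniteFlatSandwich` proves the sandwich for *every* `m`, but — `h0` being a
`finrank` with junk value `0` — each inequality only when the larger space of sections is known to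
be finite-dimensional (Mathlib has no finiteness of coherent cohomology, so
`dim_K Γ(Y, 𝒪(mD)) < ∞` for proper `Y` is not available in general). Under (G) these spaces have
positive `h0`, hence are finite-dimensional, for `m ≫ 0`. Hence:

* `CartierDivisor.sandwich_h0_of_isAmple` — (S) with the finite-dimensionality provisos, all `m`;
* `CartierDivisor.sandwich_of_growth` — **(G) implies (S)**;
* `AbelianVariety.kerRank_zsmul_id_of_growth'`, `kerRank_zsmul_id_holds_of_growth'`,
  `natCard_torsionPoints_of_isAlgClosed_of_growth'`,
  `natCard_torsionPoints_of_isAlgClosed_of_growth_of_isProjectiveOver'` — the theorems of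
  `Motives/AbelianVarietyDegreeGrowth` with (S) discharged: **`deg [n]_A = n^{2g}` and
  `#A[n](L) = n^{2g}` (`n` invertible in `K`) follow from crude growth (G), `[n]^*D ∼ n²D` for
  symmetric `D` (theorem of the cube, `pullback_zsmul_id_linEquiv`) and a symmetric ample divisor
  (resp. projectivity)** — neither the exact asymptotics of Prop. 23.83 nor the degree formula
  Prop. 23.84 remain in that trust path beyond (G).

Also: the elementary limit lemmas `tendsto_div_pow_of_isBigO` (`u(n) = α nᵉ/e! + O(nᵉ⁻¹)` ⇒
`u(n)/nᵉ → α/e!`) and `tendsto_shift_div_pow` (`v(n+a)/nᵉ` has the limit of `v(n)/nᵉ`, using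
`tendsto_add_div_pow` of `Motives/AbelianVarietyDegreeGrowth`).

Mathlib searched and used: `Asymptotics.IsBigO.trans_tendsto`, `tendsto_inv_atTop_nhds_zero_nat`,
`Filter.tendsto_add_atTop_nat`, `le_of_tendsto_of_tendsto`, `Module.finite_of_finrank_pos`; no
coherent cohomology / intersection theory in Mathlib (hence Prop. 23.83 remains a named fact).

## References

* U. Görtz, T. Wedhorn, *Algebraic Geometry II: Cohomology of Schemes*, Springer Spektrum (2023),
  doi:10.1007/978-3-658-43031-3: Def. 23.76 (p. 445); Prop. 23.77 (p. 445); Prop. 23.83,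
  Prop. 23.84, Rem. 23.85 (p. 447); Prop. 27.186, Prop. 27.188 (pp. 887–888) (read via the held
  copy, PDF pp. 443–448, 887). [GortzWedhorn2023]
* J. S. Milne, *Abelian Varieties*, in Cornell–Silverman, *Arithmetic Geometry* (1986), §8,
  Thm. 8.2 and Rem. 8.4 (pp. 115–116) (as cited in `Motives/AbelianVarietyDegreeGrowth`).
  [Milne1986AbelianVarieties]
-/

universe u

open CategoryTheory CategoryTheory.Limits AlgebraicGeometry Asymptotics Filter Topology

noncomputable section

namespace Literature.AlgebraicGeometry.Motives

/-! ### Elementary limits -/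

section Limits

/-- If `u(n) = α nᵉ/e! + O(nᵉ⁻¹)` then `u(n)/nᵉ → α/e!`. [folklore] -/
theorem tendsto_div_pow_of_isBigO {u : ℕ → ℝ} {α : ℝ} {e : ℕ}
    (h : (fun n : ℕ => u n - α * (n : ℝ) ^ e / e.factorial) =O[atTop]
      fun n : ℕ => (n : ℝ) ^ ((e : ℤ) - 1)) :
    Tendsto (fun n : ℕ => u n / (n : ℝ) ^ e) atTop (𝓝 (α / e.factorial)) := by
  -- `(u n - α nᵉ/e!)/nᵉ = O(n⁻¹) → 0`
  have h1 : (fun n : ℕ => (u n - α * (n : ℝ) ^ e / e.factorial) * ((n : ℝ) ^ e)⁻¹) =O[atTop]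
      fun n : ℕ => (n : ℝ) ^ ((e : ℤ) - 1) * ((n : ℝ) ^ e)⁻¹ :=
    h.mul (isBigO_refl _ _)
  have h2 : Tendsto (fun n : ℕ => (n : ℝ) ^ ((e : ℤ) - 1) * ((n : ℝ) ^ e)⁻¹) atTop (𝓝 0) := by
    refine (tendsto_inv_atTop_nhds_zero_nat (𝕜 := ℝ)).congr' ?_
    filter_upwards [eventually_ge_atTop 1] with n hn
    have hn0 : (n : ℝ) ≠ 0 := Nat.cast_ne_zero.2 (by omega)
    rw [zpow_sub_one₀ hn0, zpow_natCast, mul_comm, ← mul_assoc, inv_mul_cancel₀ (pow_ne_zero _ hn0),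
      one_mul]
  have h3 := h1.trans_tendsto h2
  have h4 : Tendsto (fun n : ℕ => (u n - α * (n : ℝ) ^ e / e.factorial) * ((n : ℝ) ^ e)⁻¹ +
      α / e.factorial) atTop (𝓝 (0 + α / e.factorial)) := h3.add_const _
  rw [zero_add] at h4
  refine h4.congr' ?_
  filter_upwards [eventually_ge_atTop 1] with n hn
  have hn0 : (n : ℝ) ^ e ≠ 0 := pow_ne_zero _ (Nat.cast_ne_zero.2 (by omega))
  field_simp
  ring

/-- Shifting the argument does not change the limit of `v(n)/nᵉ`: if `v(n)/nᵉ → L` then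
`v(n+a)/nᵉ → L`. [folklore] -/
theorem tendsto_shift_div_pow {v : ℕ → ℝ} {L : ℝ} {e : ℕ} (a : ℕ)
    (h : Tendsto (fun n : ℕ => v n / (n : ℝ) ^ e) atTop (𝓝 L)) :
    Tendsto (fun n : ℕ => v (n + a) / (n : ℝ) ^ e) atTop (𝓝 L) := by
  have h1 : Tendsto (fun n : ℕ => v (n + a) / ((n + a : ℕ) : ℝ) ^ e) atTop (𝓝 L) :=
    h.comp (tendsto_add_atTop_nat a)
  have h2 := h1.mul (tendsto_add_div_pow a e)
  rw [mul_one] at h2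
  refine h2.congr' ?_
  filter_upwards [eventually_ge_atTop 1] with n hn
  have hn0 : (n : ℝ) ≠ 0 := Nat.cast_ne_zero.2 (by omega)
  have hna : (n : ℝ) + a ≠ 0 := by positivity
  rw [Nat.cast_add, div_pow]
  field_simp

/-- **Comparison of leading coefficients under a shift**: if `u(n) = α nᵉ/e! + O(nᵉ⁻¹)`,
`v(n) = β nᵉ/e! + O(nᵉ⁻¹)` and `u(n) ≤ v(n + a)` for all large `n`, then `α ≤ β`. [folklore] -/
theorem le_of_isBigO_of_le_shift {u v : ℕ → ℝ} {α β : ℝ} {e : ℕ} (a : ℕ)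
    (hu : (fun n : ℕ => u n - α * (n : ℝ) ^ e / e.factorial) =O[atTop]
      fun n : ℕ => (n : ℝ) ^ ((e : ℤ) - 1))
    (hv : (fun n : ℕ => v n - β * (n : ℝ) ^ e / e.factorial) =O[atTop]
      fun n : ℕ => (n : ℝ) ^ ((e : ℤ) - 1))
    (hle : ∀ᶠ n : ℕ in atTop, u n ≤ v (n + a)) : α ≤ β := by
  have h1 := tendsto_div_pow_of_isBigO hu
  have h2 := tendsto_shift_div_pow a (tendsto_div_pow_of_isBigO hv)
  have h3 : α / e.factorial ≤ β / e.factorial := by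
    refine le_of_tendsto_of_tendsto h1 h2 ?_
    filter_upwards [hle] with n hn
    exact div_le_div_of_nonneg_right hn (pow_nonneg (Nat.cast_nonneg n) e)
  have hf : (0 : ℝ) < e.factorial := Nat.cast_pos.2 (Nat.factorial_pos e)
  exact (div_le_div_iff_of_pos_right hf).1 h3

end Limits

/-! ### Finite-dimensionality of sections from a positive asymptotic degree -/

namespace CartierDivisor

variable {X : Scheme.{u}} [IsIntegral X] {K : Type u} [Field K] [X.Over (Spec (.of K))]
  {D : CartierDivisor X}

/-- If `h⁰(nD) = δ nᵈ/d! + O(nᵈ⁻¹)` with `δ > 0` then `h⁰(nD) > 0`, in particular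
`Γ(X, 𝒪(nD))` is finite-dimensional (`h0` is a `finrank`), for all large `n`. [folklore] -/
theorem HasAsympDegree.eventually_finiteDimensional {d δ : ℕ} (h : D.HasAsympDegree K d δ)
    (hδ : 0 < δ) : ∀ᶠ n : ℕ in atTop, FiniteDimensional K ((n • D).sections K) := by
  have ht := tendsto_div_pow_of_isBigO h
  have hpos : (0 : ℝ) < δ / d.factorial :=
    div_pos (Nat.cast_pos.2 hδ) (Nat.cast_pos.2 (Nat.factorial_pos d))
  have hev := ht.eventually (lt_mem_nhds hpos)
  filter_upwards [hev] with n hn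
  have h0pos : 0 < (n • D).h0 K := by
    by_contra hc
    have : ((n • D).h0 K : ℝ) = 0 := by exact_mod_cast Nat.le_zero.1 (not_lt.1 hc)
    rw [this, zero_div] at hn
    exact lt_irrefl _ hn
  exact Module.finite_of_finrank_pos h0pos

end CartierDivisor

/-! ### Prop. 23.84 for asymptotic degrees from Prop. 23.83 -/

namespace CartierDivisor

open FunctionFieldOver

/-- **`deg(f^*D) = r · deg(D)` for the `h⁰`-asymptotic degrees, from asymptotic Riemann–Roch**
(Görtz–Wedhorn II, Prop. 23.84 in the form `CartierDivisor.asympDegree_pullback_eq`, deduced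
from Prop. 23.83 `asymptoticRiemannRoch_of_isAmple` instead of intersection theory): for
`f : X → Y` finite flat surjective of constant rank `r` between integral proper `K`-schemes and
`D` ample on `Y`, Prop. 23.83 gives `h⁰(nD) = δ nᵉ/e! + O(nᵉ⁻¹)`, `h⁰(n f^*D) = δ' nᵉ/e! + O(nᵉ⁻¹)`
(`e = dim Y = dim X`, `f^*D` ample), and the sandwich `r h⁰(mD) ≤ h⁰((m+a) f^*D)`,
`h⁰(m f^*D) ≤ r h⁰((m+a)D)` (`exists_sandwich_h0`, `r = [K(X) : K(Y)]` by
`FunctionFieldOver.finrank_eq_finrank_of_forall_eq`) forces `δ' = r δ`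
(`le_of_isBigO_of_le_shift`). [cite: GortzWedhorn2023, Prop. 23.84 with Prop. 23.83 and Def. 23.76 (pp. 445–447)] -/
theorem asympDegree_pullback_eq_of_asymptoticRiemannRoch
    (h₁ : asymptoticRiemannRoch_of_isAmple.{u}) : asympDegree_pullback_eq.{u} := by
  intro K _ X Y _ _ _ _ _ _ f _ _ _ _ r hr D hD
  -- the two asymptotic degrees, in the common dimension `e`
  obtain ⟨δ, hδ, hDδ⟩ := h₁ K Y D hD
  obtain ⟨δ', hδ', hD'δ'⟩ := h₁ K X (D.pullback f) (hD.pullback f)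
  rw [hD'δ'.asympDegree_eq, hDδ.asympDegree_eq]
  rw [Scheme.schemeDim_eq_of_isFinite_of_surjective f] at hD'δ'
  -- `r = [K(X) : K(Y)]`
  have hrK : Module.finrank Y.functionField (FunctionFieldOver f) = r :=
    finrank_eq_finrank_of_forall_eq f hr
  -- the sandwich, from the ampleness data at the generic point
  obtain ⟨hc, -, d, -, H⟩ := hD
  obtain ⟨s, hs, hηs, haff⟩ := H (genericPoint Y)
  obtain ⟨a, ha⟩ := D.exists_sandwich_h0 f K hs hηs haff
  rw [hrK] at ha
  -- finite-dimensionality for large `n`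
  have hfinY := hDδ.eventually_finiteDimensional hδ
  have hfinX := hD'δ'.eventually_finiteDimensional hδ'
  have hfinY' : ∀ᶠ m : ℕ in atTop, FiniteDimensional K (((m + a) • D).sections K) :=
    (tendsto_add_atTop_nat a).eventually hfinY
  have hfinX' : ∀ᶠ m : ℕ in atTop, FiniteDimensional K (((m + a) • D.pullback f).sections K) :=
    (tendsto_add_atTop_nat a).eventually hfinX
  -- `r δ ≤ δ'`
  have h_le : (r : ℝ) * δ ≤ δ' := by
    refine le_of_isBigO_of_le_shift (u := fun n : ℕ => (r : ℝ) * (n • D).h0 K)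
      (v := fun n : ℕ => ((n • D.pullback f).h0 K : ℝ)) (e := schemeDim Y) a ?_ hD'δ' ?_
    · have := hDδ.const_mul_left (r : ℝ)
      refine this.congr_left fun n => ?_
      ring
    · filter_upwards [hfinX'] with m hm
      exact_mod_cast (ha m).1 hm
  -- `δ' ≤ r δ`
  have h_ge : (δ' : ℝ) ≤ r * δ := by
    refine le_of_isBigO_of_le_shift (u := fun n : ℕ => ((n • D.pullback f).h0 K : ℝ))
      (v := fun n : ℕ => (r : ℝ) * (n • D).h0 K) (e := schemeDim Y) a hD'δ' ?_ ?_
    · have := hDδ.const_mul_left (r : ℝ)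
      refine this.congr_left fun n => ?_
      ring
    · filter_upwards [hfinY'] with m hm
      exact_mod_cast (ha m).2 hm
  exact_mod_cast le_antisymm h_ge h_le

end CartierDivisor

/-! ### Consequences for abelian varieties: `deg [n]_A = n^{2g}` without Prop. 23.84 -/

namespace AbelianVariety

variable {K : Type u} [Field K] (A : AbelianVariety K)

/-- **`deg [n]_A = n^{2g}` for `n` invertible in `K`** (Görtz–Wedhorn II, Prop. 27.186) from
asymptotic Riemann–Roch for ample divisors (Prop. 23.83), `[n]^*D ∼ n²D` for symmetric `D`
(Prop. 27.184) and a symmetric ample divisor (Prop. 27.174 / Rem. 27.185) — the assembly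
`kerRank_zsmul_id_of_facts` with its hypothesis Prop. 23.84 (`asympDegree_pullback_eq`) now
*proved* from Prop. 23.83 (`asympDegree_pullback_eq_of_asymptoticRiemannRoch`).
[cite: GortzWedhorn2023, Prop. 27.186 (p. 887)] -/
theorem kerRank_zsmul_id_of_asymptoticRiemannRoch
    (h₁ : CartierDivisor.asymptoticRiemannRoch_of_isAmple.{u}) (h₃ : A.pullback_zsmul_id_linEquiv)
    (h₄ : A.exists_isAmple_symmetric) (n : ℤ) (hn : (n : K) ≠ 0) :
    Hom.kerRank (n • 𝟙 A) = n.natAbs ^ (2 * A.dim) :=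
  kerRank_zsmul_id_of_facts h₁
    (CartierDivisor.asympDegree_pullback_eq_of_asymptoticRiemannRoch h₁) h₃ h₄ n hn

/-- **The named fact `kerRank_zsmul_id A`** (`deg [n]_A = n^{2g}` for all `n ≠ 0`,
Görtz–Wedhorn II, Prop. 27.186) from `isIsogeny_zsmul_id A`, Prop. 23.83, Prop. 27.184 and a
symmetric ample divisor — Prop. 23.84 being proved from Prop. 23.83.
[cite: GortzWedhorn2023, Prop. 27.186 (p. 887)] -/
theorem kerRank_zsmul_id_of_asymptoticRiemannRoch_of_isIsogeny (h₀ : isIsogeny_zsmul_id A)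
    (h₁ : CartierDivisor.asymptoticRiemannRoch_of_isAmple.{u}) (h₃ : A.pullback_zsmul_id_linEquiv)
    (h₄ : A.exists_isAmple_symmetric) : kerRank_zsmul_id A :=
  kerRank_zsmul_id_of_facts_of_isIsogeny h₀ h₁
    (CartierDivisor.asympDegree_pullback_eq_of_asymptoticRiemannRoch h₁) h₃ h₄

/-- **The named fact `natCard_torsionPoints_of_isAlgClosed A L`** (`#A[n](L) = n^{2g}`,
Görtz–Wedhorn II, Prop. 27.188 (1)) from Prop. 23.83, Prop. 27.184 and projectivity of abelian
varieties (`AbelianVariety.isProjectiveOver`) — the assembly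
`natCard_torsionPoints_of_isAlgClosed_of_namedFacts` with Prop. 23.84 proved from Prop. 23.83.
[cite: GortzWedhorn2023, Prop. 27.188 (1) with Prop. 27.186 (pp. 887–888)] -/
theorem natCard_torsionPoints_of_isAlgClosed_of_asymptoticRiemannRoch (L : Type u) [Field L]
    [Algebra K L] (h₁ : CartierDivisor.asymptoticRiemannRoch_of_isAmple.{u})
    (h₃ : A.pullback_zsmul_id_linEquiv) (h₄ : AbelianVariety.isProjectiveOver (k := K)) :
    natCard_torsionPoints_of_isAlgClosed A L :=
  natCard_torsionPoints_of_isAlgClosed_of_namedFacts L h₁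
    (CartierDivisor.asympDegree_pullback_eq_of_asymptoticRiemannRoch h₁) h₃ h₄

end AbelianVariety

/-! ### The sandwich (S) from crude growth (G) -/

namespace CartierDivisor

open FunctionFieldOver

variable (K : Type u) [Field K]

/-- **The sandwich for an ample divisor along a finite flat cover** (all `m`, with
finite-dimensionality provisos): for `f : X → Y` finite flat surjective of constant rank `r`
between integral `K`-schemes and `D` ample on `Y` there is `a` with
`r h⁰(mD) ≤ h⁰((m+a) f^*D)` whenever the right-hand space is finite-dimensional and
`h⁰(m f^*D) ≤ r h⁰((m+a) D)` whenever `Γ(Y, 𝒪((m+a)D))` is — `CartierDivisor.exists_sandwich_h0`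
at the generic point of `Y` (an affine `Y_s ∋ η` from ampleness) with
`[K(X) : K(Y)] = r` (`FunctionFieldOver.finrank_eq_finrank_of_forall_eq`). [folklore] -/
theorem sandwich_h0_of_isAmple {X Y : Scheme.{u}} [IsIntegral X] [IsIntegral Y]
    [X.Over (Spec (.of K))] [Y.Over (Spec (.of K))] (f : X ⟶ Y) [f.IsOver (Spec (.of K))]
    [IsFinite f] [Flat f] [Surjective f] (r : ℕ) (hr : ∀ y : Y, f.finrank y = r)
    (D : CartierDivisor Y) (hD : D.IsAmple) :
    ∃ a : ℕ, ∀ m : ℕ,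
      (FiniteDimensional K (((m + a) • D.pullback f).sections K) →
        r * (m • D).h0 K ≤ ((m + a) • D.pullback f).h0 K) ∧
      (FiniteDimensional K (((m + a) • D).sections K) →
        (m • D.pullback f).h0 K ≤ r * ((m + a) • D).h0 K) := by
  obtain ⟨hc, -, d, -, H⟩ := hD
  obtain ⟨s, hs, hηs, haff⟩ := H (genericPoint Y)
  have h := D.exists_sandwich_h0 f K hs hηs haff
  rwa [finrank_eq_finrank_of_forall_eq f hr] at h

/-- **Crude growth (G) implies the sandwich (S)** in the exact form of the hypotheses of
`Motives/AbelianVarietyDegreeGrowth`: under (G) the spaces `Γ(Y, 𝒪(mD))`, `Γ(X, 𝒪(m f^*D))`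
(`f^*D` is ample, `IsAmple.pullback`) have positive `h0`, hence are finite-dimensional, for
`m ≫ 0`, so `sandwich_h0_of_isAmple` applies unconditionally from some `m₁` on. [folklore] -/
theorem sandwich_of_growth
    (hG : ∀ (Y : Scheme.{u}) [IsIntegral Y] [Y.Over (Spec (.of K))] [IsProper (Y ↘ Spec (.of K))]
      (D : CartierDivisor Y), D.IsAmple →
      ∃ (c C : ℝ) (m₀ : ℕ), 0 < c ∧ ∀ m : ℕ, m₀ ≤ m →
        c * (m : ℝ) ^ schemeDim Y ≤ ((m • D).h0 K : ℝ) ∧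
          ((m • D).h0 K : ℝ) ≤ C * (m : ℝ) ^ schemeDim Y) :
    ∀ (X Y : Scheme.{u}) [IsIntegral X] [IsIntegral Y] [X.Over (Spec (.of K))]
      [Y.Over (Spec (.of K))] [IsProper (X ↘ Spec (.of K))] [IsProper (Y ↘ Spec (.of K))]
      (f : X ⟶ Y) [f.IsOver (Spec (.of K))] [IsFinite f] [Flat f] [Surjective f] (r : ℕ),
      (∀ y : Y, f.finrank y = r) → ∀ (D : CartierDivisor Y), D.IsAmple →
      ∃ (a m₁ : ℕ), ∀ m : ℕ, m₁ ≤ m →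
        r * (m • D).h0 K ≤ ((m + a) • D.pullback f).h0 K ∧
          (m • D.pullback f).h0 K ≤ r * ((m + a) • D).h0 K := by
  intro X Y _ _ _ _ _ _ f _ _ _ _ r hr D hD
  obtain ⟨a, ha⟩ := sandwich_h0_of_isAmple K f r hr D hD
  -- positivity of `h0`, hence finite-dimensionality, for `m ≫ 0` on `Y` and on `X`
  have hfin : ∀ (Z : Scheme.{u}) [IsIntegral Z] [Z.Over (Spec (.of K))]
      [IsProper (Z ↘ Spec (.of K))] (E : CartierDivisor Z), E.IsAmple →
      ∃ m₀ : ℕ, ∀ m : ℕ, m₀ ≤ m → FiniteDimensional K ((m • E).sections K) := by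
    intro Z _ _ _ E hE
    obtain ⟨c, C, m₀, hc, hm⟩ := hG Z E hE
    refine ⟨max m₀ 1, fun m hmle => ?_⟩
    have hm₀ : m₀ ≤ m := le_trans (le_max_left _ _) hmle
    have hm1 : 1 ≤ m := le_trans (le_max_right _ _) hmle
    have h1 := (hm m hm₀).1
    have hpos : (0 : ℝ) < (m • E).h0 K :=
      lt_of_lt_of_le (mul_pos hc (pow_pos (Nat.cast_pos.2 hm1) _)) h1
    exact Module.finite_of_finrank_pos (Nat.cast_pos.1 hpos)
  obtain ⟨m₀, hm₀⟩ := hfin Y D hD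
  obtain ⟨m₀', hm₀'⟩ := hfin X (D.pullback f) (hD.pullback f)
  refine ⟨a, max m₀ m₀', fun m hm => ⟨(ha m).1 (hm₀' _ ?_), (ha m).2 (hm₀ _ ?_)⟩⟩
  · exact le_trans (le_trans (le_max_right _ _) hm) (Nat.le_add_right _ _)
  · exact le_trans (le_trans (le_max_left _ _) hm) (Nat.le_add_right _ _)

end CartierDivisor

/-! ### `deg [n]_A = n^{2g}` from crude growth, the cube and a symmetric ample divisor -/

namespace AbelianVariety

variable {K : Type u} [Field K] (A : AbelianVariety K)

/-- **`deg [n]_A = n^{2g}` for `n` invertible in `K` from crude growth (G), the cube and a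
symmetric ample divisor** (Görtz–Wedhorn II, Prop. 27.186; Milne 1986, Thm. 8.2):
`kerRank_zsmul_id_of_growth` (`Motives/AbelianVarietyDegreeGrowth`) with its sandwich hypothesis
(S) proved from (G) (`CartierDivisor.sandwich_of_growth`). [cite: GortzWedhorn2023, Prop. 27.186] -/
theorem kerRank_zsmul_id_of_growth'
    (hG : ∀ (Y : Scheme.{u}) [IsIntegral Y] [Y.Over (Spec (.of K))] [IsProper (Y ↘ Spec (.of K))]
      (D : CartierDivisor Y), D.IsAmple →
      ∃ (c C : ℝ) (m₀ : ℕ), 0 < c ∧ ∀ m : ℕ, m₀ ≤ m →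
        c * (m : ℝ) ^ schemeDim Y ≤ ((m • D).h0 K : ℝ) ∧
          ((m • D).h0 K : ℝ) ≤ C * (m : ℝ) ^ schemeDim Y)
    (h₃ : A.pullback_zsmul_id_linEquiv) (h₄ : A.exists_isAmple_symmetric) (n : ℤ)
    (hn : (n : K) ≠ 0) :
    Hom.kerRank (n • 𝟙 A) = n.natAbs ^ (2 * A.dim) :=
  kerRank_zsmul_id_of_growth A hG (CartierDivisor.sandwich_of_growth K hG) h₃ h₄ n hn

/-- **The named fact `kerRank_zsmul_id A`** (`deg [n]_A = n^{2g}` for all `n ≠ 0`,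
Görtz–Wedhorn II, Prop. 27.186) from crude growth (G), the cube, a symmetric ample divisor and
`isIsogeny_zsmul_id A`: `kerRank_zsmul_id_holds_of_growth` with (S) proved from (G).
[cite: GortzWedhorn2023, Prop. 27.186] -/
theorem kerRank_zsmul_id_holds_of_growth'
    (hG : ∀ (Y : Scheme.{u}) [IsIntegral Y] [Y.Over (Spec (.of K))] [IsProper (Y ↘ Spec (.of K))]
      (D : CartierDivisor Y), D.IsAmple →
      ∃ (c C : ℝ) (m₀ : ℕ), 0 < c ∧ ∀ m : ℕ, m₀ ≤ m →
        c * (m : ℝ) ^ schemeDim Y ≤ ((m • D).h0 K : ℝ) ∧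
          ((m • D).h0 K : ℝ) ≤ C * (m : ℝ) ^ schemeDim Y)
    (h₀ : isIsogeny_zsmul_id A) (h₃ : A.pullback_zsmul_id_linEquiv)
    (h₄ : A.exists_isAmple_symmetric) : kerRank_zsmul_id A :=
  kerRank_zsmul_id_holds_of_growth A hG (CartierDivisor.sandwich_of_growth K hG) h₀ h₃ h₄

/-- **`#A[n](L) = n^{2g}`** (the named fact `natCard_torsionPoints_of_isAlgClosed A L`,
Görtz–Wedhorn II, Prop. 27.188 (1); Milne 1986, Rem. 8.4) from crude growth (G), the cube and a
symmetric ample divisor: `natCard_torsionPoints_of_isAlgClosed_of_growth` with (S) proved from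
(G). [cite: GortzWedhorn2023, Prop. 27.188 (1)] -/
theorem natCard_torsionPoints_of_isAlgClosed_of_growth' (L : Type u) [Field L] [Algebra K L]
    (hG : ∀ (Y : Scheme.{u}) [IsIntegral Y] [Y.Over (Spec (.of K))] [IsProper (Y ↘ Spec (.of K))]
      (D : CartierDivisor Y), D.IsAmple →
      ∃ (c C : ℝ) (m₀ : ℕ), 0 < c ∧ ∀ m : ℕ, m₀ ≤ m →
        c * (m : ℝ) ^ schemeDim Y ≤ ((m • D).h0 K : ℝ) ∧
          ((m • D).h0 K : ℝ) ≤ C * (m : ℝ) ^ schemeDim Y)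
    (h₃ : A.pullback_zsmul_id_linEquiv) (h₄ : A.exists_isAmple_symmetric) :
    natCard_torsionPoints_of_isAlgClosed A L :=
  natCard_torsionPoints_of_isAlgClosed_of_growth A hG (CartierDivisor.sandwich_of_growth K hG)
    L h₃ h₄

/-- **`#A[n](L) = n^{2g}` for a projective abelian variety** from crude growth (G) and the cube:
`natCard_torsionPoints_of_isAlgClosed_of_growth_of_isProjectiveOver` with (S) proved from (G).
[cite: GortzWedhorn2023, Prop. 27.188 (1)] -/
theorem natCard_torsionPoints_of_isAlgClosed_of_growth_of_isProjectiveOver' (L : Type u)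
    [Field L] [Algebra K L]
    (hG : ∀ (Y : Scheme.{u}) [IsIntegral Y] [Y.Over (Spec (.of K))] [IsProper (Y ↘ Spec (.of K))]
      (D : CartierDivisor Y), D.IsAmple →
      ∃ (c C : ℝ) (m₀ : ℕ), 0 < c ∧ ∀ m : ℕ, m₀ ≤ m →
        c * (m : ℝ) ^ schemeDim Y ≤ ((m • D).h0 K : ℝ) ∧
          ((m • D).h0 K : ℝ) ≤ C * (m : ℝ) ^ schemeDim Y)
    (h₃ : A.pullback_zsmul_id_linEquiv) (h₄ : IsProjectiveOver A.X) :
    natCard_torsionPoints_of_isAlgClosed A L :=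
  natCard_torsionPoints_of_isAlgClosed_of_growth_of_isProjectiveOver A hG
    (CartierDivisor.sandwich_of_growth K hG) L h₃ h₄

end AbelianVariety

end Literature.AlgebraicGeometry.Motives

end
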